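import Mathlib
import HarnessLib

/-!
# TwoNotchClockworkExt — the exact conveyor and the cosine law (STAGING; nogo gen 17 riders 4–5)

search for candidate a priori estimates; no regularity claim.

Companion to `NoGo/TwoNotchClockwork.lean` (v1, in the tree as p266709): the real-analysis half of COLLAPSE-ADDENDUM-4 add-4/add-5,
self-contained (imports Mathlib only; no dependence on the combinatorial §A–§C).
  §D  (add-4) EXACT CONVEYOR: a dead channel hands M's gap pair to P reversed, r′(P)·r(M) = 1, dead links transport |log r| exactly
      (`conveyor_exact`, `kappa_exact`, `rr_exact`, `dead_run_abs`, `dead_link_sign`); the add-4 sign-lemma certificates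
      (`sin_ratio_G`, `rhoG_cert`, `sin_ratio_F`, `rhoF_cert`) — true, superseded by §E.
  §E  (add-5) the COSINE LAW: tan a − tan b = sin(a−b)/(cos a cos b) (`tan_sub_tan`) collapses add-3 §5's channel constants to
      ρ_G = κ₀·cos μ_B/cos μ_A and ρ_F = κ₀·cos μ_A/cos μ_B exactly (`rhoG_cosine_law`, `rhoF_cosine_law`), κ₀ = sin(η₂/2)/sin((t+u)/2) < 1
      (`kappa0_lt_one`); both channels of a main read r(M) through the same factor q = cos μ_A/cos μ_B, so the class signs agree
      (`main_law_exclusive`) and the reduced variable log r − log q is ±Λ (`reduced_sign`): laws (M), (P) and the propagation of add-3 need no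
      hypothesis on the directors (THEOREM R₇♮ of add-5: Conjecture R (T2)₂ in the strict book under (S)(E)(Per) alone — pen; the kinematic
      lemmas are prose).
-/

namespace Summit.NavierStokesRegularity.FunctionalMining.TwoNotchClockworkExt

/-! ## §D  add-4: the conveyor is exact (κ ≡ 1); no-slack transport; numeric core of the sign lemma -/

/-- EXACT CONVEYOR C♯ (add-4 §1): the spacing g·Δ laid by M during an M-gap Δ at separation speed g is consumed by P at the
SAME speed g (P's mid while closing on that front equals M's mid while laying it), so the P-gap is Δ exactly. -/
theorem conveyor_exact (g Δ : ℝ) (hg : g ≠ 0) : g * Δ / g = Δ := by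
  field_simp

/-- hence κ = (s_B · c′)/(g_A · c″) with c′ = g_A, c″ = s_B is identically 1, for every director configuration. -/
theorem kappa_exact (gA sB : ℝ) (hg : gA ≠ 0) (hs : sB ≠ 0) : (sB * gA) / (gA * sB) = 1 := by
  rw [mul_comm]; exact div_self (mul_ne_zero hg hs)

/-- and r′(P) · r(M) = 1 exactly (r(M) = Y_AB/Y_BA, r′(P) = Y′_A′B′/Y′_B′A′ = Y_BA/Y_AB). -/
theorem rr_exact (yab yba : ℝ) (h1 : yab ≠ 0) (h2 : yba ≠ 0) : (yba / yab) * (yab / yba) = 1 := by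
  field_simp

/-- LEMMA N along a dead run: x_{k+1} = −x_k exactly, so |x| is constant (no slack, no K). -/
theorem dead_run_abs (x : ℕ → ℝ) (h : ∀ k, x (k + 1) = -x k) (n : ℕ) : |x n| = |x 0| := by
  induction n with
  | zero => rfl
  | succ n ih => rw [h n, abs_neg, ih]

/-- a dead link flips the sign exactly: x′ = −x with x ≠ 0 gives x′·x < 0. -/
theorem dead_link_sign (x x' : ℝ) (h : x' = -x) (hx : x ≠ 0) : x' * x < 0 := by
  subst h; have := mul_self_pos.mpr hx; nlinarith

/-- trig enclosure for LEMMA S (a): sin 0.36 / sin 0.17 < 2.14 (from sin x ≤ x and x − x³/6 < sin x). -/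
theorem sin_ratio_G : Real.sin 0.36 / Real.sin 0.17 < 2.14 := by
  have h1 : Real.sin 0.36 ≤ 0.36 := Real.sin_le (by norm_num)
  have h2 : (0.17 : ℝ) - 0.17 ^ 3 / 6 < Real.sin 0.17 := Real.sin_gt_sub_cube (by norm_num)
  have h3 : (0 : ℝ) < Real.sin 0.17 := by nlinarith
  rw [div_lt_iff₀ h3]; nlinarith

/-- LAG type: ρ_G ≤ (η₂/(t+u)) · (sin 0.36 / sin 0.17)² < (2/34) · 2.14² < 1 at the canonical sizes. -/
theorem rhoG_cert : (2 : ℝ) / 34 * 2.14 ^ 2 < 1 := by norm_num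

/-- trig enclosure for LEMMA S (b): for 0.065 ≤ w ≤ π/2, sin (w + 0.19) / sin w < 4.1 (< √17). -/
theorem sin_ratio_F (w : ℝ) (hw : 0.065 ≤ w) (hw' : w ≤ Real.pi / 2) :
    Real.sin (w + 0.19) / Real.sin w < 4.1 := by
  have h65 : (0.065 : ℝ) - 0.065 ^ 3 / 6 < Real.sin 0.065 := Real.sin_gt_sub_cube (by norm_num)
  have hs0 : Real.sin 0.065 ≤ Real.sin w := by
    rcases eq_or_lt_of_le hw with h | h
    · rw [h]
    · exact le_of_lt (Real.sin_lt_sin_of_lt_of_le_pi_div_two (by linarith [Real.pi_gt_three]) hw' h)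
  have hpos : 0 < Real.sin w := by linarith
  have hadd : Real.sin (w + 0.19) = Real.sin w * Real.cos 0.19 + Real.cos w * Real.sin 0.19 := Real.sin_add _ _
  have hc1 : Real.cos 0.19 ≤ 1 := Real.cos_le_one _
  have hc2 : Real.cos w ≤ 1 := Real.cos_le_one _
  have hs19 : Real.sin 0.19 ≤ 0.19 := Real.sin_le (by norm_num)
  have hs19' : 0 ≤ Real.sin 0.19 :=
    Real.sin_nonneg_of_nonneg_of_le_pi (by norm_num) (by linarith [Real.pi_gt_three])
  have e1 : Real.sin w * Real.cos 0.19 ≤ Real.sin w := by nlinarith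
  have e2 : Real.cos w * Real.sin 0.19 ≤ 0.19 := by nlinarith
  rw [div_lt_iff₀ hpos, hadd]
  linarith

/-- FRONTHOOD type: ρ_F ≤ (η₂/(t+u)) · (sin(w+0.19)/sin w)² < (2/34) · 4.1² < 1 when the main is ≥ 0.065 rad from vertical. -/
theorem rhoF_cert : (2 : ℝ) / 34 * 4.1 ^ 2 < 1 := by norm_num

/-! ## §E  add-5: the COSINE LAW — the exact GAP-LAW constants in closed form; the main law needs no hypothesis -/

/-- tan a − tan b = sin (a − b) / (cos a · cos b) for cos a, cos b ≠ 0: the one trigonometric input of the cosine law. -/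
theorem tan_sub_tan (a b : ℝ) (ha : Real.cos a ≠ 0) (hb : Real.cos b ≠ 0) :
    Real.tan a - Real.tan b = Real.sin (a - b) / (Real.cos a * Real.cos b) := by
  rw [Real.tan_eq_sin_div_cos, Real.tan_eq_sin_div_cos, Real.sin_sub]
  field_simp

/-- COSINE LAW, LAG type G (add-5 §1). With add-3 §5's channel constants of the R-channel of a −d main (right level β after
a B-event) written as tangent differences — e₀ + g_A = T(β−t+d/2) − T(β−t−u/2), e₀ = T(β−t/2) − T(β−t−u/2), c₀ = T(β−u/2) − T(β−t/2),
m_B = T(β+d/2) − T(β−u/2) — the exact GAP-LAW constant ρ_G = (1 + g_A/e₀)·(c₀/m_B) equals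
[sin(η₂/2)/sin((t+u)/2)] · cos μ_B / cos μ_A, μ_B = β + d/2 and μ_A = β − t + d/2 the main's two mids: it depends on the MAIN only. -/
theorem rhoG_cosine_law (β d t u : ℝ)
    (h1 : Real.cos (β - u / 2) ≠ 0) (h2 : Real.cos (β - t / 2) ≠ 0) (h3 : Real.cos (β + d / 2) ≠ 0)
    (h4 : Real.cos (β - t + d / 2) ≠ 0) (h5 : Real.cos (β - t - u / 2) ≠ 0)
    (hs1 : Real.sin ((t + u) / 2) ≠ 0) (hs2 : Real.sin ((d + u) / 2) ≠ 0) :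
    ((Real.tan (β - t + d / 2) - Real.tan (β - t - u / 2)) / (Real.tan (β - t / 2) - Real.tan (β - t - u / 2))) *
      ((Real.tan (β - u / 2) - Real.tan (β - t / 2)) / (Real.tan (β + d / 2) - Real.tan (β - u / 2)))
      = (Real.sin ((t - u) / 2) / Real.sin ((t + u) / 2)) * (Real.cos (β + d / 2) / Real.cos (β - t + d / 2)) := by
  rw [tan_sub_tan _ _ h4 h5, tan_sub_tan _ _ h2 h5, tan_sub_tan _ _ h1 h2, tan_sub_tan _ _ h3 h1]
  have e1 : β - t + d / 2 - (β - t - u / 2) = (d + u) / 2 := by ring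
  have e2 : β - t / 2 - (β - t - u / 2) = (t + u) / 2 := by ring
  have e3 : β - u / 2 - (β - t / 2) = (t - u) / 2 := by ring
  have e4 : β + d / 2 - (β - u / 2) = (d + u) / 2 := by ring
  rw [e1, e2, e3, e4]
  generalize Real.cos (β - u / 2) = c1 at *
  generalize Real.cos (β - t / 2) = c2 at *
  generalize Real.cos (β + d / 2) = c3 at *
  generalize Real.cos (β - t + d / 2) = c4 at *
  generalize Real.cos (β - t - u / 2) = c5 at *
  generalize Real.sin ((t + u) / 2) = S1 at *
  generalize Real.sin ((d + u) / 2) = S2 at *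
  generalize Real.sin ((t - u) / 2) = S3 at *
  field_simp

/-- COSINE LAW, FRONTHOOD type F (add-5 §1): m_B = T(β+d/2) − T(β+u/2), c₀ = T(β+u/2) − T(β−t/2), e₀ = T(β−t/2) − T(β−t+u/2),
e₀ + g_A = T(β−t+d/2) − T(β−t+u/2); ρ_F = (m_B/c₀)·(e₀/(e₀+g_A)) = [sin(η₂/2)/sin((t+u)/2)] · cos μ_A / cos μ_B. -/
theorem rhoF_cosine_law (β d t u : ℝ)
    (h1 : Real.cos (β + d / 2) ≠ 0) (h2 : Real.cos (β + u / 2) ≠ 0) (h3 : Real.cos (β - t / 2) ≠ 0)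
    (h4 : Real.cos (β - t + u / 2) ≠ 0) (h5 : Real.cos (β - t + d / 2) ≠ 0)
    (hs1 : Real.sin ((t + u) / 2) ≠ 0) (hs2 : Real.sin ((d - u) / 2) ≠ 0) :
    ((Real.tan (β + d / 2) - Real.tan (β + u / 2)) / (Real.tan (β + u / 2) - Real.tan (β - t / 2))) *
      ((Real.tan (β - t / 2) - Real.tan (β - t + u / 2)) / (Real.tan (β - t + d / 2) - Real.tan (β - t + u / 2)))
      = (Real.sin ((t - u) / 2) / Real.sin ((t + u) / 2)) * (Real.cos (β - t + d / 2) / Real.cos (β + d / 2)) := by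
  rw [tan_sub_tan _ _ h1 h2, tan_sub_tan _ _ h2 h3, tan_sub_tan _ _ h3 h4, tan_sub_tan _ _ h5 h4]
  have e1 : β + d / 2 - (β + u / 2) = (d - u) / 2 := by ring
  have e2 : β + u / 2 - (β - t / 2) = (t + u) / 2 := by ring
  have e3 : β - t / 2 - (β - t + u / 2) = (t - u) / 2 := by ring
  have e4 : β - t + d / 2 - (β - t + u / 2) = (d - u) / 2 := by ring
  rw [e1, e2, e3, e4]
  generalize Real.cos (β + d / 2) = c1 at *
  generalize Real.cos (β + u / 2) = c2 at *
  generalize Real.cos (β - t / 2) = c3 at *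
  generalize Real.cos (β - t + u / 2) = c4 at *
  generalize Real.cos (β - t + d / 2) = c5 at *
  generalize Real.sin ((t + u) / 2) = S1 at *
  generalize Real.sin ((d - u) / 2) = S2 at *
  generalize Real.sin ((t - u) / 2) = S3 at *
  field_simp

/-- κ₀ := sin(η₂/2)/sin((t+u)/2) < 1 for 0 < u < t with (t+u)/2 ≤ π/2, so Λ := log(1/κ₀) > 0. -/
theorem kappa0_lt_one (t u : ℝ) (hu : 0 < u) (hut : u < t) (h : (t + u) / 2 ≤ Real.pi / 2) :
    Real.sin ((t - u) / 2) / Real.sin ((t + u) / 2) < 1 := by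
  have hlt : Real.sin ((t - u) / 2) < Real.sin ((t + u) / 2) :=
    Real.sin_lt_sin_of_lt_of_le_pi_div_two (by linarith [Real.pi_gt_three]) h (by linarith)
  have hpos : 0 < Real.sin ((t + u) / 2) :=
    Real.sin_pos_of_pos_of_lt_pi (by linarith) (by linarith [Real.pi_gt_three])
  rwa [div_lt_one hpos]

/-- MAIN LAW (M), unconditional form (add-5 §2): two live channels of one −d main read the same main ratio r = Y_AB/Y_BA and the
same main factor q = cos μ_A/cos μ_B > 0; a channel of class +1 forces r = q/κ₀, one of class −1 forces r = κ₀·q; with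
0 < κ₀ < 1 the two classes cannot coexist — χ_L = χ_R, for every director configuration. -/
theorem main_law_exclusive (r q κ : ℝ) (hq : 0 < q) (hk0 : 0 < κ) (hk1 : κ < 1)
    (hplus : r = q / κ) (hminus : r = κ * q) : False := by
  have h1 : q = κ * κ * q := by
    field_simp at hplus; nlinarith [hplus, hminus]
  nlinarith [mul_pos hq hk0, mul_lt_mul_of_pos_right hk1 hq]

/-- REDUCED SIGN VARIABLE (add-5 §2): x̂ := log r − log q equals +Λ or −Λ exactly (Λ = −log κ₀ > 0), so its sign is the class sign with
NO inequality on the directors; the dead-link transport x̂ ↦ −x̂ (`dead_run_abs`) and the two pins at a +d main give the propagation law. -/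
theorem reduced_sign (r q κ χ : ℝ) (hq : 0 < q) (hk0 : 0 < κ) (hχ : χ = 1 ∨ χ = -1)
    (h : r = q * κ ^ (-(χ : ℝ))) : Real.log r - Real.log q = χ * (-Real.log κ) := by
  rcases hχ with hχ | hχ <;> subst hχ
  · have : r = q / κ := by rw [h, Real.rpow_neg hk0.le, Real.rpow_one]; field_simp
    rw [this, Real.log_div hq.ne' hk0.ne']; ring
  · have : r = q * κ := by rw [h]; norm_num
    rw [this, Real.log_mul hq.ne' hk0.ne']; ring

end Summit.NavierStokesRegularity.FunctionalMining.TwoNotchClockworkExt
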